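import Summits.PneNP.PneNP.Theses.EquivariantThetaLift
import Literature.Computability.Complexity.MatchingEffectiveDerivation
import HarnessLib

/-!
# Route `EquivariantThetaLift`, item `MatchingEffectiveDerivationV`: closed by BBCHPRRWZ Thm 4.9

The route item `Summit.PneNP.PneNP.Theses.EquivariantThetaLift.MatchingEffectiveDerivationV` (for even
`n`, a real polynomial on the edges of `K_n` vanishing on all perfect matchings is derivable from the
matching axioms in degree `2 · deg F`) is PROVED in the tree as
`Literature.Computability.Complexity.Mod2.matchingEffectiveDerivationV`
(`Literature/Computability/Complexity/MatchingEffectiveDerivation.lean`: Braun–Brown-Cohen–Huq–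
Pokutta–Raghavendra–Roy–Weitz–Zink 2017, Thm. 4.9, via Lemmas 4.4–4.8). Nothing is re-proved here
(D-0059).
-/

set_option linter.dupNamespace false -- `Summit.PneNP.PneNP.…`: summit = sub-problem (D-0017)

namespace Summit.PneNP.PneNP.Theorems

/-- **Item `MatchingEffectiveDerivationV` of route `EquivariantThetaLift`** — BBCHPRRWZ Thm 4.9
(vanishing form), by the tree theorem
`Literature.Computability.Complexity.Mod2.matchingEffectiveDerivationV`.
[cite: BraunEtAl2016, Thm. 4.9 (p. 9)] -/
theorem MatchingEffectiveDerivationV_proof :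
    Summit.PneNP.PneNP.Theses.EquivariantThetaLift.MatchingEffectiveDerivationV :=
  Literature.Computability.Complexity.Mod2.matchingEffectiveDerivationV

end Summit.PneNP.PneNP.Theorems
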